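import Literature.NumberTheory.Automorphic.WhittakerColumnProjectors
import HarnessLib

/-!
# The Iwahori factorisation `K(L) = (K(L) ∩ U_n)(K(L) ∩ B_n⁻)` of the principal congruence subgroups

Topic `NumberTheory/Automorphic`; namespace `Literature.NumberTheory.Automorphic`. Theorems only
(plus two explicit auxiliary matrices with bodies, `rowsBelow`/`rowsAbove`, and the `ℕ`-indexed
variant `IsTopLeftNat` of `WhittakerSupercuspidal.IsTopLeft`); no named fact, no instance, no `sorry`.

`GLnCongruenceSubgroups` proves the two-block Iwahori-type factorisation
`K_γ = (K_γ ∩ U_c)(K_γ ∩ P_c⁻)` of a principal congruence subgroup `K_γ = congruenceGL n γ`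
(`γ < 1`) of `GL_n(F)` with respect to a maximal parabolic. This file proves the factorisation with
respect to the **Borel**: every `k ∈ K_γ` is `k = u b` with `u ∈ U_n ∩ K_γ` upper unitriangular and
`b ∈ B_n⁻ ∩ K_γ` lower triangular, **uniquely**, and compatibly with the top-left corners
`diag(GL_t, 1)` (`exists_unitriangular_mul_lower_of_mem_congruenceGL`,
`unitriangular_mul_lower_unique`). The proof is Gauss elimination one column at a time
(the pivot `k_{tt} ≡ 1` is a unit): clear the column `t` above the diagonal by the column element
`c_t(x)`, `x_i = k_{it}/k_{tt}` (`WhittakerSupercuspidal.colElem`), and split the remainder `p`,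
whose rows `< t` vanish in the columns `≥ t`, as `p = Ã ℓ` with `Ã` (resp. `ℓ`) equal to `p` with the
rows `≥ t` (resp. `< t`) replaced by the corresponding rows of `1` — `Ã` is a smaller top-left corner
in `K_γ`, `ℓ` is lower triangular. We also record that torus conjugation preserves both factors
(`zpowDiagGL` normalises `U_n` and `B_n⁻`). (Casselman (1995), Prop. 1.4.4; Bernstein–Zelevinsky
(1976), §3.11; Bushnell–Henniart (2006), (7.3.1) for `GL_2`.)

## References

* W. Casselman, *Introduction to the theory of admissible representations of `p`-adic reductive
  groups*, unpublished notes (1995), §1.4, Prop. 1.4.4 [Casselman1995].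
* I. N. Bernstein, A. V. Zelevinsky, *Representations of the group `GL(n,F)` where `F` is a
  non-archimedean local field*, Russian Math. Surveys 31:3 (1976), §3 [BernsteinZelevinsky1976].
-/

noncomputable section

open scoped MatrixGroups
open ValuativeRel Matrix

namespace Literature.NumberTheory.Automorphic

open WhittakerSupercuspidal

variable {F : Type*} [Field F] {n : ℕ}

/-! ### Top-left corners indexed by natural numbers -/

/-- `M` is the identity outside its top-left `s × s` corner (`s : ℕ`; for `s = t.val` this is
`IsTopLeft t`, and it is vacuous for `s ≥ n`). [folklore] -/
def IsTopLeftNat (s : ℕ) (M : Matrix (Fin n) (Fin n) F) : Prop :=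
  ∀ r c : Fin n, (s ≤ (r : ℕ) ∨ s ≤ (c : ℕ)) → M r c = if r = c then 1 else 0

/-- For `s = t.val`, `IsTopLeftNat` is `IsTopLeft`. [folklore] -/
theorem isTopLeftNat_iff_isTopLeft (t : Fin n) (M : Matrix (Fin n) (Fin n) F) :
    IsTopLeftNat (t : ℕ) M ↔ IsTopLeft t M := by
  simp only [IsTopLeftNat, IsTopLeft, Fin.le_def]

/-- The condition is vacuous for `s ≥ n`. [folklore] -/
theorem isTopLeftNat_of_le {s : ℕ} (hs : n ≤ s) (M : Matrix (Fin n) (Fin n) F) : IsTopLeftNat s M :=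
  fun r _ h => by rcases h with h | h <;> omega

/-- Monotonicity in `s`. [folklore] -/
theorem IsTopLeftNat.mono {s s' : ℕ} {M : Matrix (Fin n) (Fin n) F} (h : IsTopLeftNat s M) (hs : s ≤ s') :
    IsTopLeftNat s' M := fun r c hrc => h r c (by omega)

/-- Only the identity is top-left of size `0`. [folklore] -/
theorem IsTopLeftNat.eq_one_of_zero {M : Matrix (Fin n) (Fin n) F} (h : IsTopLeftNat 0 M) : M = 1 := by
  ext r c; rw [h r c (Or.inl (Nat.zero_le _)), Matrix.one_apply]

/-- The identity is top-left of every size. [folklore] -/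
theorem isTopLeftNat_one (s : ℕ) : IsTopLeftNat s (1 : Matrix (Fin n) (Fin n) F) := fun r c _ => by
  rw [Matrix.one_apply]

/-- Products of top-left matrices are top-left. [folklore] -/
theorem IsTopLeftNat.mul {s : ℕ} {M N : Matrix (Fin n) (Fin n) F} (hM : IsTopLeftNat s M) (hN : IsTopLeftNat s N) :
    IsTopLeftNat s (M * N) := by
  rcases le_or_gt n s with hs | hs
  · exact isTopLeftNat_of_le hs _
  · have := (isTopLeftNat_iff_isTopLeft ⟨s, hs⟩ _).1 hM
    exact (isTopLeftNat_iff_isTopLeft ⟨s, hs⟩ _).2 (this.mul ((isTopLeftNat_iff_isTopLeft ⟨s, hs⟩ _).1 hN))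

/-- The inverse of a top-left element of `GL_n` is top-left. [folklore] -/
theorem IsTopLeftNat.inv {s : ℕ} {g : GL (Fin n) F} (hg : IsTopLeftNat s (g : Matrix (Fin n) (Fin n) F)) :
    IsTopLeftNat s ((g⁻¹ : GL (Fin n) F) : Matrix (Fin n) (Fin n) F) := by
  rcases le_or_gt n s with hs | hs
  · exact isTopLeftNat_of_le hs _
  · exact (isTopLeftNat_iff_isTopLeft ⟨s, hs⟩ _).2 (WhittakerBessel.IsTopLeft.inv ((isTopLeftNat_iff_isTopLeft ⟨s, hs⟩ _).1 hg))

/-! ### Replacing rows by the rows of the identity -/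

/-- `p` with the rows `≥ t` replaced by the rows of `1` (the top-left corner `Ã = A ⊕ 1` when the rows
`< t` of `p` vanish in the columns `≥ t`). [folklore] -/
def rowsAbove (t : Fin n) (p : Matrix (Fin n) (Fin n) F) : Matrix (Fin n) (Fin n) F :=
  Matrix.of fun i j => if i < t then p i j else if i = j then 1 else 0

/-- `p` with the rows `< t` replaced by the rows of `1`. [folklore] -/
def rowsBelow (t : Fin n) (p : Matrix (Fin n) (Fin n) F) : Matrix (Fin n) (Fin n) F :=
  Matrix.of fun i j => if i < t then (if i = j then 1 else 0) else p i j

/-- Entries of `rowsAbove`. [folklore] -/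
@[simp] theorem rowsAbove_apply (t : Fin n) (p : Matrix (Fin n) (Fin n) F) (i j : Fin n) :
    rowsAbove t p i j = if i < t then p i j else if i = j then 1 else 0 := rfl

/-- Entries of `rowsBelow`. [folklore] -/
@[simp] theorem rowsBelow_apply (t : Fin n) (p : Matrix (Fin n) (Fin n) F) (i j : Fin n) :
    rowsBelow t p i j = if i < t then (if i = j then 1 else 0) else p i j := rfl

/-- **`Ã ℓ = p`** when the rows `< t` of `p` vanish in the columns `≥ t`. [folklore] -/
theorem rowsAbove_mul_rowsBelow (t : Fin n) {p : Matrix (Fin n) (Fin n) F}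
    (hp : ∀ i j : Fin n, i < t → t ≤ j → p i j = 0) : rowsAbove t p * rowsBelow t p = p := by
  ext i j
  rw [Matrix.mul_apply]
  by_cases hi : i < t
  · -- row `i < t`: `∑_k p_{ik} ℓ_{kj}`; only `k < t` contribute, where `ℓ_{kj} = δ_{kj}`
    have : ∀ k, rowsAbove t p i k * rowsBelow t p k j = if k = j ∧ k < t then p i j else 0 := by
      intro k
      rw [rowsAbove_apply, rowsBelow_apply, if_pos hi]
      by_cases hk : k < t
      · rw [if_pos hk]
        by_cases hkj : k = j
        · subst hkj; simp [hk]
        · simp [hkj]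
      · rw [hp i k hi (not_lt.1 hk), zero_mul]
        simp [hk]
    simp_rw [this]
    rw [Finset.sum_ite, Finset.sum_const_zero, add_zero, Finset.sum_const]
    by_cases hj : j < t
    · rw [show (Finset.univ.filter fun k => k = j ∧ k < t) = {j} from ?_, Finset.card_singleton, one_smul]
      ext k; simp only [Finset.mem_filter, Finset.mem_univ, true_and, Finset.mem_singleton]
      exact ⟨fun h => h.1, fun h => ⟨h, h ▸ hj⟩⟩
    · rw [show (Finset.univ.filter fun k => k = j ∧ k < t) = ∅ from ?_, Finset.card_empty, zero_smul,
        hp i j hi (not_lt.1 hj)]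
      ext k; simp only [Finset.mem_filter, Finset.mem_univ, true_and, Finset.notMem_empty, iff_false, not_and]
      rintro rfl; exact hj
  · -- row `i ≥ t`: the row `e_i` of `Ã` picks the row `i` of `ℓ`, which is the row `i` of `p`
    have : ∀ k, rowsAbove t p i k * rowsBelow t p k j = if k = i then p i j else 0 := by
      intro k
      rw [rowsAbove_apply, if_neg hi]
      by_cases hik : i = k
      · subst hik; rw [if_pos rfl, one_mul, rowsBelow_apply, if_neg hi, if_pos rfl]
      · rw [if_neg hik, zero_mul, if_neg (Ne.symm hik)]
    simp_rw [this]
    rw [Finset.sum_ite_eq' Finset.univ i, if_pos (Finset.mem_univ _)]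

/-- `Ã` is top-left of size `t` when the rows `< t` of `p` vanish in the columns `≥ t`. [folklore] -/
theorem isTopLeftNat_rowsAbove (t : Fin n) {p : Matrix (Fin n) (Fin n) F}
    (hp : ∀ i j : Fin n, i < t → t ≤ j → p i j = 0) : IsTopLeftNat (t : ℕ) (rowsAbove t p) := by
  intro r c h
  rw [rowsAbove_apply]
  by_cases hr : r < t
  · rw [if_pos hr]
    have hc : t ≤ c := by
      rcases h with h | h
      · exact absurd hr (not_lt.2 (Fin.le_def.2 h))
      · exact Fin.le_def.2 h
    rw [hp r c hr hc, if_neg]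
    rintro rfl; exact absurd hr (not_lt.2 hc)
  · rw [if_neg hr]

/-- `ℓ` is lower triangular when `p` is the identity in the rows `≥ t+1`-corner sense: if
`p_{ij} = δ_{ij}` whenever `i ≥ t` and `j > i`. [folklore] -/
theorem rowsBelow_apply_eq_zero_of_lt (t : Fin n) {p : Matrix (Fin n) (Fin n) F}
    (hp : ∀ i j : Fin n, t ≤ i → i < j → p i j = 0) {i j : Fin n} (hij : i < j) : rowsBelow t p i j = 0 := by
  rw [rowsBelow_apply]
  by_cases hi : i < t
  · rw [if_pos hi, if_neg (ne_of_lt hij)]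
  · rw [if_neg hi]; exact hp i j (not_lt.1 hi) hij

section Valued

variable [ValuativeRel F]

/-- **Membership in `K_γ` from the bound on `g - 1` alone** (`γ < 1`): the inverse of a matrix
`≡ 1 mod γ` is integral and `≡ 1 mod γ` (`isUnit_det_and_valBound_inv`). [folklore] -/
theorem mem_congruenceGL_of_valBound_sub_one {γ : ValueGroupWithZero F} (hγ : γ < 1) {g : GL (Fin n) F}
    (h : ValBound γ ((g : Matrix (Fin n) (Fin n) F) - 1)) : g ∈ congruenceGL n γ := by
  obtain ⟨-, hinv, hinv1⟩ := isUnit_det_and_valBound_inv h hγ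
  have hcoe : ((g⁻¹ : GL (Fin n) F) : Matrix (Fin n) (Fin n) F) = (g : Matrix (Fin n) (Fin n) F)⁻¹ :=
    Matrix.coe_units_inv g
  rw [mem_congruenceGL_iff]
  refine ⟨⟨h.of_sub_one hγ.le, ?_⟩, h, ?_⟩
  · rw [hcoe]; exact hinv
  · rw [hcoe]; exact hinv1

/-- Bounds on the entries of an element of `K_γ`. [folklore] -/
theorem valuation_apply_sub_one_le_of_mem_congruenceGL {γ : ValueGroupWithZero F} {g : GL (Fin n) F}
    (hg : g ∈ congruenceGL n γ) (i j : Fin n) :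
    valuation F ((g : Matrix (Fin n) (Fin n) F) i j - if i = j then 1 else 0) ≤ γ := by
  have := hg.2.1 i j
  rwa [Matrix.sub_apply, Matrix.one_apply] at this

/-- The diagonal entries of an element of `K_γ`, `γ < 1`, are units (a private copy of the lemma of the
same name in `GodementJacquetAtoms`, to keep the imports light). [folklore] -/
private theorem valuation_pivot_eq_one_of_mem_congruenceGL {γ : ValueGroupWithZero F} (hγ : γ < 1)
    {g : GL (Fin n) F} (hg : g ∈ congruenceGL n γ) (i : Fin n) :
    valuation F ((g : Matrix (Fin n) (Fin n) F) i i) = 1 := by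
  have h := valuation_apply_sub_one_le_of_mem_congruenceGL hg i i
  rw [if_pos rfl] at h
  have := WhittakerBessel.valuation_one_add_eq_one (h.trans_lt hγ)
  rwa [add_sub_cancel] at this

/-! ### The factorisation -/

/-- **Iwahori factorisation of `K_γ` with respect to the Borel, compatibly with top-left corners.**
For `γ < 1` and every `s`, every `k ∈ K_γ = congruenceGL n γ` which is the identity outside its
top-left `s × s` corner factors as `k = u b` with `u ∈ U_n ∩ K_γ` upper unitriangular,
`b ∈ B_n⁻ ∩ K_γ` lower triangular, both the identity outside the top-left `s × s` corner. Proof by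
induction on `s` (Gauss elimination): clear the column `s` above the diagonal by `c_s(x)`,
`x_i = k_{is}/k_{ss}` (the pivot is a unit), split the remainder `p = Ã ℓ` (`rowsAbove_mul_rowsBelow`)
and factor the smaller corner `Ã`. (Casselman (1995), Prop. 1.4.4.) [folklore] -/
theorem exists_unitriangular_mul_lower_of_mem_congruenceGL {γ : ValueGroupWithZero F} (hγ : γ < 1) (s : ℕ)
    {k : GL (Fin n) F} (hk : k ∈ congruenceGL n γ) (hks : IsTopLeftNat s (k : Matrix (Fin n) (Fin n) F)) :
    ∃ u b : GL (Fin n) F, u ∈ upperUnitriangular (Fin n) F ∧ b ∈ oppositeParabolicGL F (id : Fin n → Fin n) ∧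
      u ∈ congruenceGL n γ ∧ b ∈ congruenceGL n γ ∧
      IsTopLeftNat s (u : Matrix (Fin n) (Fin n) F) ∧ IsTopLeftNat s (b : Matrix (Fin n) (Fin n) F) ∧
      k = u * b := by
  classical
  induction s generalizing k with
  | zero =>
    have h1 : k = 1 := Units.ext (by rw [hks.eq_one_of_zero, Units.val_one])
    exact ⟨1, 1, Subgroup.one_mem _, Subgroup.one_mem _, Subgroup.one_mem _, Subgroup.one_mem _,
      isTopLeftNat_one _, isTopLeftNat_one _, by rw [h1, mul_one]⟩
  | succ s ih =>
    rcases le_or_gt n s with hns | hns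
    · -- vacuous step
      obtain ⟨u, b, hu, hb, huK, hbK, hus, hbs, hkub⟩ := ih hk (isTopLeftNat_of_le hns _)
      exact ⟨u, b, hu, hb, huK, hbK, hus.mono (Nat.le_succ _), hbs.mono (Nat.le_succ _), hkub⟩
    set t : Fin n := ⟨s, hns⟩ with ht
    have htv : (t : ℕ) = s := rfl
    set K : Matrix (Fin n) (Fin n) F := (k : Matrix (Fin n) (Fin n) F) with hK
    -- the pivot and the column operation
    have hd : valuation F (K t t) = 1 := valuation_pivot_eq_one_of_mem_congruenceGL hγ hk t
    have hd0 : K t t ≠ 0 := fun h => by rw [h, map_zero] at hd; exact zero_ne_one hd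
    set x : Fin n → F := fun i => if i < t then K i t / K t t else 0 with hx
    have hxv : ∀ i, i < t → valuation F (x i) ≤ γ := by
      intro i hi
      simp only [hx, if_pos hi, map_div₀, hd, div_one]
      have := valuation_apply_sub_one_le_of_mem_congruenceGL hk i t
      rwa [if_neg (ne_of_lt hi), sub_zero] at this
    set u₁ : GL (Fin n) F := colElem t x with hu₁
    have hu₁N : u₁ ∈ upperUnitriangular (Fin n) F := WhittakerBessel.colElem_mem_upperUnitriangular t x
    have hu₁K : u₁ ∈ congruenceGL n γ := WhittakerBessel.colElem_mem_congruenceGL hγ.le hxv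
    have hu₁tl : IsTopLeftNat (s + 1) ((u₁ : GL (Fin n) F) : Matrix (Fin n) (Fin n) F) := by
      intro r c h
      rw [hu₁, colElem_apply]
      have : ¬ (r < t ∧ c = t) := by
        rintro ⟨hr, rfl⟩
        rw [Fin.lt_def, htv] at hr
        rcases h with h | h <;> omega
      rw [if_neg this, add_zero]
    -- the remainder `p = u₁⁻¹ k`
    set p : GL (Fin n) F := u₁⁻¹ * k with hp
    set P : Matrix (Fin n) (Fin n) F := (p : Matrix (Fin n) (Fin n) F) with hP
    have hPdef : P = (1 - colMat t x) * K := by rw [hP, hp, Units.val_mul, hu₁, coe_colElem_inv]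
    have hPK : p ∈ congruenceGL n γ := Subgroup.mul_mem _ (Subgroup.inv_mem _ hu₁K) hk
    have hPtl : IsTopLeftNat (s + 1) P := (hu₁tl.inv).mul hks
    -- entries of `P`: the rows `≥ t` are those of `K`, the rows `< t` are `K_{ij} - x_i K_{tj}`
    have hP_ge : ∀ i j, ¬ i < t → P i j = K i j := by
      intro i j hi
      rw [hPdef, Matrix.sub_mul, Matrix.one_mul, Matrix.sub_apply, Matrix.mul_apply]
      rw [Finset.sum_eq_zero fun l _ => ?_, sub_zero]
      rw [colMat_apply, if_neg (fun h => hi h.1), zero_mul]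
    have hP_lt : ∀ i j, i < t → P i j = K i j - x i * K t j := by
      intro i j hi
      rw [hPdef, Matrix.sub_mul, Matrix.one_mul, Matrix.sub_apply, Matrix.mul_apply]
      congr 1
      rw [Finset.sum_eq_single t (fun l _ hl => by rw [colMat_apply, if_neg (fun h => hl h.2), zero_mul])
        (fun h => absurd (Finset.mem_univ t) h), colMat_apply, if_pos ⟨hi, rfl⟩]
    -- the column `t` is cleared above the diagonal, and the rows `< t` vanish in the columns `≥ t`
    have hPzero : ∀ i j : Fin n, i < t → t ≤ j → P i j = 0 := by
      intro i j hi hj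
      rcases hj.lt_or_eq with hj | rfl
      · -- `j > t`: both `K_{ij}` and `K_{tj}` vanish
        have hj' : s + 1 ≤ (j : ℕ) := by rw [Fin.lt_def, htv] at hj; omega
        rw [hP_lt i j hi, hks i j (Or.inr hj'), hks t j (Or.inr hj'), if_neg (ne_of_lt (hi.trans hj)),
          if_neg (ne_of_lt hj), mul_zero, sub_zero]
      · rw [hP_lt i t hi, hx]; dsimp only; rw [if_pos hi, div_mul_cancel₀ _ hd0, sub_self]
    have hPlow : ∀ i j : Fin n, t ≤ i → i < j → P i j = 0 := by
      intro i j hi hij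
      have hj' : s + 1 ≤ (j : ℕ) := by rw [Fin.le_def, htv] at hi; rw [Fin.lt_def] at hij; omega
      rw [hPtl i j (Or.inr hj'), if_neg (ne_of_lt hij)]
    -- the split `p = Ã ℓ`
    have hsplit : rowsAbove t P * rowsBelow t P = P := rowsAbove_mul_rowsBelow t hPzero
    have hdetP : P.det ≠ 0 := by
      rw [hP, ← Matrix.GeneralLinearGroup.val_det_apply]; exact (Matrix.GeneralLinearGroup.det p).ne_zero
    have hdet : (rowsAbove t P).det ≠ 0 ∧ (rowsBelow t P).det ≠ 0 := by
      rw [← mul_ne_zero_iff, ← Matrix.det_mul, hsplit]; exact hdetP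
    set A : GL (Fin n) F := Matrix.GeneralLinearGroup.mkOfDetNeZero (rowsAbove t P) hdet.1 with hA
    set Lw : GL (Fin n) F := Matrix.GeneralLinearGroup.mkOfDetNeZero (rowsBelow t P) hdet.2 with hLw
    have hAcoe : ((A : GL (Fin n) F) : Matrix (Fin n) (Fin n) F) = rowsAbove t P := rfl
    have hLcoe : ((Lw : GL (Fin n) F) : Matrix (Fin n) (Fin n) F) = rowsBelow t P := rfl
    have hpAL : p = A * Lw := by
      apply Units.ext
      change P = ((A * Lw : GL (Fin n) F) : Matrix (Fin n) (Fin n) F)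
      rw [Units.val_mul, hAcoe, hLcoe, hsplit]
    -- `Ã ∈ K_γ` is a top-left corner of size `s`; `ℓ ∈ K_γ` is lower triangular
    have hPval : ∀ i j, valuation F (P i j - if i = j then 1 else 0) ≤ γ :=
      valuation_apply_sub_one_le_of_mem_congruenceGL hPK
    have hAK : A ∈ congruenceGL n γ := by
      refine mem_congruenceGL_of_valBound_sub_one hγ fun i j => ?_
      rw [Matrix.sub_apply, hAcoe, rowsAbove_apply, Matrix.one_apply]
      by_cases hi : i < t
      · rw [if_pos hi]; exact hPval i j
      · rw [if_neg hi, sub_self, map_zero]; exact zero_le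
    have hLK : Lw ∈ congruenceGL n γ := by
      refine mem_congruenceGL_of_valBound_sub_one hγ fun i j => ?_
      rw [Matrix.sub_apply, hLcoe, rowsBelow_apply, Matrix.one_apply]
      by_cases hi : i < t
      · rw [if_pos hi, sub_self, map_zero]; exact zero_le
      · rw [if_neg hi]; exact hPval i j
    have hAtl : IsTopLeftNat s ((A : GL (Fin n) F) : Matrix (Fin n) (Fin n) F) := by
      rw [hAcoe, ← htv]; exact isTopLeftNat_rowsAbove t hPzero
    have hLtl : IsTopLeftNat (s + 1) ((Lw : GL (Fin n) F) : Matrix (Fin n) (Fin n) F) := by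
      intro r c h
      rw [hLcoe, rowsBelow_apply]
      by_cases hr : r < t
      · rw [if_pos hr]
      · rw [if_neg hr]; exact hPtl r c h
    have hLlow : Lw ∈ oppositeParabolicGL F (id : Fin n → Fin n) := by
      refine (mem_oppositeParabolicGL_iff _).2 fun i j hij => ?_
      rw [hLcoe]; exact rowsBelow_apply_eq_zero_of_lt t hPlow hij
    -- factor the smaller corner and reassemble
    obtain ⟨u', b', hu'N, hb'B, hu'K, hb'K, hu'tl, hb'tl, hAub⟩ := ih hAK hAtl
    refine ⟨u₁ * u', b' * Lw, Subgroup.mul_mem _ hu₁N hu'N, Subgroup.mul_mem _ hb'B hLlow,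
      Subgroup.mul_mem _ hu₁K hu'K, Subgroup.mul_mem _ hb'K hLK, ?_, ?_, ?_⟩
    · rw [Units.val_mul]; exact hu₁tl.mul (hu'tl.mono (Nat.le_succ _))
    · rw [Units.val_mul]; exact (hb'tl.mono (Nat.le_succ _)).mul hLtl
    · calc k = u₁ * p := by rw [hp, mul_inv_cancel_left]
        _ = u₁ * u' * (b' * Lw) := by rw [hpAL, hAub]; group

/-- **The whole group**: every `k ∈ K_γ` (`γ < 1`) is `u b` with `u ∈ U_n ∩ K_γ`, `b ∈ B_n⁻ ∩ K_γ`.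
[folklore] -/
theorem exists_unitriangular_mul_lower_of_mem_congruenceGL' {γ : ValueGroupWithZero F} (hγ : γ < 1)
    {k : GL (Fin n) F} (hk : k ∈ congruenceGL n γ) :
    ∃ u b : GL (Fin n) F, u ∈ upperUnitriangular (Fin n) F ∧ b ∈ oppositeParabolicGL F (id : Fin n → Fin n) ∧
      u ∈ congruenceGL n γ ∧ b ∈ congruenceGL n γ ∧ k = u * b := by
  obtain ⟨u, b, hu, hb, huK, hbK, -, -, h⟩ :=
    exists_unitriangular_mul_lower_of_mem_congruenceGL hγ n hk (isTopLeftNat_of_le le_rfl _)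
  exact ⟨u, b, hu, hb, huK, hbK, h⟩

end Valued

/-- **Uniqueness of the factorisation**: `U_n ∩ B_n⁻ = 1`. [folklore] -/
theorem unitriangular_mul_lower_unique {u u' b b' : GL (Fin n) F}
    (hu : u ∈ upperUnitriangular (Fin n) F) (hu' : u' ∈ upperUnitriangular (Fin n) F)
    (hb : b ∈ oppositeParabolicGL F (id : Fin n → Fin n)) (hb' : b' ∈ oppositeParabolicGL F (id : Fin n → Fin n))
    (h : u * b = u' * b') : u = u' ∧ b = b' := by
  have hw : u'⁻¹ * u = b' * b⁻¹ := by
    rw [inv_mul_eq_iff_eq_mul, ← mul_assoc, ← h, mul_inv_cancel_right]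
  have hwN : u'⁻¹ * u ∈ upperUnitriangular (Fin n) F := Subgroup.mul_mem _ (Subgroup.inv_mem _ hu') hu
  have hwB : u'⁻¹ * u ∈ oppositeParabolicGL F (id : Fin n → Fin n) := by
    rw [hw]; exact Subgroup.mul_mem _ hb' (Subgroup.inv_mem _ hb)
  have hw1 : u'⁻¹ * u = 1 := by
    refine Units.ext (Matrix.ext fun i j => ?_)
    rcases lt_trichotomy i j with hij | rfl | hij
    · rw [(mem_oppositeParabolicGL_iff _).1 hwB i j hij, Units.val_one, Matrix.one_apply_ne (ne_of_lt hij)]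
    · rw [((mem_unipotentRadicalGL_iff_apply _).1 hwN) i i le_rfl, Units.val_one]
    · rw [((mem_unipotentRadicalGL_iff_apply _).1 hwN) i j hij.le, Units.val_one]
  constructor
  · have := hw1
    rwa [inv_mul_eq_one, eq_comm] at this
  · have : b' * b⁻¹ = 1 := by rw [← hw]; exact hw1
    rw [mul_inv_eq_one] at this
    exact this.symm

/-! ### Torus conjugation preserves both factors -/

/-- Conjugation by a diagonal torus element preserves the lower triangular group. [folklore] -/
theorem zpowDiagGL_mul_mul_inv_mem_lower {ϖ : F} (hϖ : ϖ ≠ 0) (a : Fin n → ℤ)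
    {b : GL (Fin n) F} (hb : b ∈ oppositeParabolicGL F (id : Fin n → Fin n)) :
    zpowDiagGL hϖ a * b * (zpowDiagGL hϖ a)⁻¹ ∈ oppositeParabolicGL F (id : Fin n → Fin n) := by
  rw [mem_oppositeParabolicGL_iff] at hb ⊢
  intro i j hij
  rw [coe_zpowDiagGL_mul_mul_inv_apply, hb i j hij, mul_zero]

/-- Conjugation by a diagonal torus element preserves top-left corners. [folklore] -/
theorem IsTopLeftNat.zpowDiagGL_conj {ϖ : F} (hϖ : ϖ ≠ 0) (a : Fin n → ℤ) {s : ℕ}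
    {g : GL (Fin n) F} (hg : IsTopLeftNat s (g : Matrix (Fin n) (Fin n) F)) :
    IsTopLeftNat s ((zpowDiagGL hϖ a * g * (zpowDiagGL hϖ a)⁻¹ : GL (Fin n) F) : Matrix (Fin n) (Fin n) F) := by
  intro i j h
  rw [coe_zpowDiagGL_mul_mul_inv_apply, hg i j h]
  by_cases hij : i = j
  · subst hij; rw [if_pos rfl, sub_self, zpow_zero, one_mul]
  · rw [if_neg hij, mul_zero]

end Literature.NumberTheory.Automorphic
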